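import Mathlib
import Summits.ResolutionOfSingularities.ResolutionOfSingularities.Theorems.RadicialJungCleanModelsBadSetDescent
import Summits.ResolutionOfSingularities.ResolutionOfSingularities.Theorems.RadicialJungCleanModelsCleanRegTransport
import Literature.AlgebraicGeometry.Resolution.QuasiExcellentBlowup
import HarnessLib

/-!
# Route `RadicialJung`, crux `CleanModels` (stmt-ResolutionOfSingularities-15917), line `Sketch` rev 35, stub 6 `stub_cleanProp44` (X44c),
# work plan O8 / L7b-global: PERSISTENCE of the descent-step data along a chain of point blow-ups

Memo `Cruxes/CleanModels/Lines/Sketch-memo-hand2-g9-stubs-5-7.md` §3b.  To iterate the descent step ✓ `exists_pointChain_ncard_bad_lt`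
(`…BadSetDescent.lean`) one needs its hypotheses again on the new stage `(X, C, σ^♯ G)` of a chain `σ : X → X₀` following `C₀ = cl{η}` with base
point `σ x ≠ η`:
* `IsPointChainAlong.isQuasiExcellent` — quasi-excellence persists (✓ `IsBlowup.isQuasiExcellent`);
* `IsPointChainAlong.mem_closure_sdiff` — the end point lies in the closure of the rest of the strict transform;
* `IsPointChainAlong.curve_data` — the strict transform is `C = cl{η'}` for the unique `η'` over `η`; its points other than `η'` are closed in
  `X` and have three-dimensional local rings (given the same for `C₀`); and clean-regularity of the line at a point `σ y ≠ σ x` of `C₀` lifts to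
  `y` (✓ `CleanRegAt.functionFieldMap_of_isIso_stalkMap`) — all because `σ` is an isomorphism off `σ x` (✓ p816363) and the end point is the
  only point of `C` over `σ x` (✓ p816640).

Honest framing: OURS (bookkeeping); the induction assembling L7b-global and the output predicate (O6) remain; nothing here proves X44c or any case
of `CleanModels`.
-/

noncomputable section

set_option linter.dupNamespace false -- mandated namespace of this single-conjunct summit

open CategoryTheory AlgebraicGeometry TopologicalSpace IsLocalRing Opposite
open Literature.AlgebraicGeometry.Resolution Literature.AlgebraicGeometry.Motives
open Scheme.IdealSheafData

namespace Summit.ResolutionOfSingularities.ResolutionOfSingularities.Theorems.RadicialJung.CleanModels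

universe u

/-- Quasi-excellence persists along a chain of point blow-ups. [cite: StacksProject, Tag 07QU] -/
theorem IsPointChainAlong.isQuasiExcellent {X₀ X : Scheme.{u}} {σ : X ⟶ X₀} {C₀ : Closeds X₀} {C : Closeds X} {x : X} {n : ℕ}
    (h : IsPointChainAlong σ C₀ C x n) [IsLocallyNoetherian X₀] (hE : Scheme.IsQuasiExcellent X₀) : Scheme.IsQuasiExcellent X := by
  induction h with
  | nil C₀ x₀ => exact hE
  | cons σ C₀ C n τ x' hx hchain hYreg hτ hx' ih => exact hτ.isQuasiExcellent ih

/-- Along a chain, the end point lies in the closure of the rest of the strict transform (given the same at the start). [folklore] -/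
theorem IsPointChainAlong.mem_closure_sdiff {X₀ X : Scheme.{u}} {σ : X ⟶ X₀} {C₀ : Closeds X₀} {C : Closeds X} {x : X} {n : ℕ}
    (h : IsPointChainAlong σ C₀ C x n) (h0 : σ x ∈ closure ((C₀ : Set X₀) \ {σ x})) : x ∈ closure ((C : Set X) \ {x}) := by
  induction h with
  | nil C₀ x₀ => simpa using h0
  | cons σ C₀ C n τ x' hx hchain hYreg hτ hx' ih =>
    have hsub : τ ⁻¹' ((C : Set _) \ {τ x'}) ⊆ closure (τ ⁻¹' ((C : Set _) \ {τ x'})) \ {x'} := fun z hz =>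
      ⟨subset_closure hz, fun hzx => hz.2 (by rw [Set.mem_singleton_iff] at hzx; rw [hzx]; rfl)⟩
    exact closure_mono hsub hx'

/-- **Persistence of the curve data along a chain.**  See the module docstring. [cite: CossartPiltant2008, Prop. 4.4 (proof, p. 10)]
[cite: GortzWedhorn2020, Prop. 13.91 (3)] [cite: StacksProject, Tag 080E] -/
theorem IsPointChainAlong.curve_data {X₀ X : Scheme.{0}} [IsIntegral X₀] [IsIntegral X] [IsLocallyNoetherian X₀] [IsLocallyNoetherian X]
    {σ : X ⟶ X₀} [IsDominant σ] {C₀ : Closeds X₀} {C : Closeds X} {x : X} {n : ℕ} (h : IsPointChainAlong σ C₀ C x n)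
    (hX₀ : Scheme.IsRegular X₀)
    (hC₀reg : ∀ y ∈ (C₀ : Set X₀), ∃ c : Fin 2 → X₀.presheaf.stalk y,
      IsRsopPart c ∧ Ideal.span (Set.range c) = stalkIdeal (vanishingIdeal C₀) y)
    {η : X₀} (hη : (C₀ : Set X₀) = closure {η}) (hcl : ∀ y ∈ (C₀ : Set X₀), y ≠ η → IsClosed ({y} : Set X₀))
    (hdim3 : ∀ y ∈ (C₀ : Set X₀), y ≠ η → ringKrullDim (X₀.presheaf.stalk y) = 3)
    (hxC₀ : σ x ∈ (C₀ : Set X₀)) (hxη : σ x ≠ η) (hxcl : IsClosed ({x} : Set X)) (p : ℕ) (G : X₀.functionField) :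
    ∃ η' : X, η' ∈ (C : Set X) ∧ σ η' = η ∧ (C : Set X) = closure {η'} ∧
      (∀ y ∈ (C : Set X), y ≠ η' → IsClosed ({y} : Set X)) ∧
      (∀ y ∈ (C : Set X), y ≠ η' → ringKrullDim (X.presheaf.stalk y) = 3) ∧
      (∀ y ∈ (C : Set X), y ≠ x → σ y ∈ (C₀ : Set X₀) ∧ σ y ≠ σ x ∧
        (CleanRegAt p (RatFn.toFunctionField (σ y)) G → CleanRegAt p (RatFn.toFunctionField y) (RatFn.functionFieldMap σ G))) := by
  classical
  have hx₀cl : IsClosed ({σ x} : Set X₀) := hcl _ hxC₀ hxη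
  have hdim₀ : ringKrullDim (X₀.presheaf.stalk (σ x)) = 3 := hdim3 _ hxC₀ hxη
  obtain ⟨hX, hCreg, hxC, hdimx⟩ := data_along_pointChain h hX₀ hC₀reg hxC₀ hdim₀
  -- `σ` is an isomorphism over `U = X₀ ∖ {σ x}`
  set U : X₀.Opens := ⟨{σ x}ᶜ, hx₀cl.isOpen_compl⟩ with hU
  haveI hiso : IsIso (σ ∣_ U) := h.isIso_morphismRestrict U (fun hmem => hmem rfl)
  have hinj : Set.InjOn (fun y => σ y) (σ ⁻¹ᵁ U : Set X) := injOn_preimage_of_isIso_morphismRestrict σ U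
  have hbook : (C : Set X) ∩ σ ⁻¹' {σ x}ᶜ = σ ⁻¹' ((C₀ : Set X₀) \ {σ x}) := h.inter_preimage_compl hx₀cl
  -- points of `C` other than `x` lie over `C₀ ∖ {σ x}`
  have hoff : ∀ y ∈ (C : Set X), y ≠ x → σ y ∈ (C₀ : Set X₀) ∧ σ y ≠ σ x := by
    intro y hyC hyx
    have hne : σ y ≠ σ x := fun heq => hyx (h.eq_of_mem_of_eq hX₀ hC₀reg hxC₀ hdim₀ y hyC heq)
    have h1 : y ∈ (C : Set X) ∩ σ ⁻¹' {σ x}ᶜ := ⟨hyC, hne⟩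
    rw [hbook] at h1
    exact ⟨h1.1, hne⟩
  -- the point `η'` over `η`
  have hηU : η ∈ U := fun hmem => hxη (Set.mem_singleton_iff.mp hmem).symm
  set ηt : ↥(σ ⁻¹ᵁ U) := (inv (σ ∣_ U)) ⟨η, hηU⟩ with hηt
  have hσηt : (σ ∣_ U) ηt = ⟨η, hηU⟩ := by
    rw [hηt, ← Scheme.Hom.comp_apply, IsIso.inv_hom_id]; rfl
  set η' : X := (ηt : X) with hη'def
  have hση' : σ η' = η := by
    have := congrArg Subtype.val hσηt
    rwa [morphismRestrict_base_coe] at this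
  have hη'U : η' ∈ σ ⁻¹ᵁ U := ηt.2
  have hη'C : η' ∈ (C : Set X) := by
    have : η' ∈ σ ⁻¹' ((C₀ : Set X₀) \ {σ x}) := by
      refine ⟨?_, ?_⟩
      · rw [hση', hη]; exact subset_closure rfl
      · rw [hση']; exact fun hmem => hxη (Set.mem_singleton_iff.mp hmem).symm
    rw [← hbook] at this
    exact this.1
  -- specialisations from `η` lift along the isomorphism off `σ x`
  have hlift : ∀ y ∈ (C : Set X), y ≠ x → η' ⤳ y := by
    intro y hyC hyx
    obtain ⟨hyC₀, hne⟩ := hoff y hyC hyx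
    have hyU : y ∈ σ ⁻¹ᵁ U := hne
    have hsp₀ : η ⤳ σ y := by rw [specializes_iff_mem_closure, ← hη]; exact hyC₀
    -- in `U`
    have hspU : (⟨η, hηU⟩ : ↥U) ⤳ ⟨σ y, hne⟩ := (subtype_specializes_iff _ _).mpr hsp₀
    -- pull back along the inverse of `σ ∣_ U`
    have hspV : ηt ⤳ (inv (σ ∣_ U)) ⟨σ y, hne⟩ := hspU.map (inv (σ ∣_ U)).continuous
    have hyt : (inv (σ ∣_ U)) ⟨σ y, hne⟩ = ⟨y, hyU⟩ := by
      have h1 : (σ ∣_ U) ⟨y, hyU⟩ = ⟨σ y, hne⟩ := Subtype.ext (morphismRestrict_base_coe σ U ⟨y, hyU⟩)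
      rw [← h1, ← Scheme.Hom.comp_apply, IsIso.hom_inv_id]; rfl
    rw [hyt] at hspV
    exact (subtype_specializes_iff _ _).mp hspV
  -- `C = cl{η'}`
  have hCη' : (C : Set X) = closure {η'} := by
    apply le_antisymm
    · have hrest : (C : Set X) \ {x} ⊆ closure {η'} := fun y hy =>
        specializes_iff_mem_closure.mp (hlift y hy.1 fun heq => hy.2 heq)
      intro y hyC
      by_cases hyx : y = x
      · rw [hyx]
        have h0 : σ x ∈ closure ((C₀ : Set X₀) \ {σ x}) := by
          have hsub : ({η} : Set X₀) ⊆ (C₀ : Set X₀) \ {σ x} := by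
            rintro z hz
            rw [Set.mem_singleton_iff] at hz
            subst hz
            exact ⟨by rw [hη]; exact subset_closure rfl, fun heq => hxη (Set.mem_singleton_iff.mp heq).symm⟩
          have h1 := closure_mono hsub
          rw [← hη] at h1
          exact h1 hxC₀
        exact isClosed_closure.closure_subset_iff.mpr hrest (h.mem_closure_sdiff h0)
      · exact hrest ⟨hyC, hyx⟩
    · exact closure_minimal (Set.singleton_subset_iff.mpr hη'C) C.isClosed
  refine ⟨η', hη'C, hση', hCη', ?_, ?_, ?_⟩
  · -- closed points
    intro y hyC hyη'
    by_cases hyx : y = x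
    · rw [hyx]; exact hxcl
    obtain ⟨hyC₀, hne⟩ := hoff y hyC hyx
    have hyU : y ∈ σ ⁻¹ᵁ U := hne
    have hσyη : σ y ≠ η := by
      intro heq
      apply hyη'
      exact hinj hyU hη'U (heq.trans hση'.symm)
    have hfib : ({y} : Set X) = σ ⁻¹' {σ y} := by
      ext z
      simp only [Set.mem_singleton_iff, Set.mem_preimage]
      constructor
      · rintro rfl; rfl
      · intro hz
        have hzU : z ∈ σ ⁻¹ᵁ U := by change σ z ∈ U; rw [hz]; exact hne
        exact hinj hzU hyU hz
    rw [hfib]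
    exact (hcl _ hyC₀ hσyη).preimage σ.continuous
  · -- dimension three
    intro y hyC hyη'
    by_cases hyx : y = x
    · rw [hyx]; exact hdimx
    obtain ⟨hyC₀, hne⟩ := hoff y hyC hyx
    have hσyη : σ y ≠ η := by
      intro heq
      apply hyη'
      exact hinj (show y ∈ σ ⁻¹ᵁ U from hne) hη'U (heq.trans hση'.symm)
    obtain ⟨hisoy, -⟩ := h.stalkIdeal_eq_map_of_ne hx₀cl y hne
    haveI := hisoy
    rw [← hdim3 _ hyC₀ hσyη]
    exact (ringKrullDim_eq_of_ringEquiv (asIso (σ.stalkMap y)).commRingCatIsoToRingEquiv).symm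
  · -- clean-regularity lifts off the base point
    intro y hyC hyx
    obtain ⟨hyC₀, hne⟩ := hoff y hyC hyx
    refine ⟨hyC₀, hne, fun hG => ?_⟩
    obtain ⟨hisoy, -⟩ := h.stalkIdeal_eq_map_of_ne hx₀cl y hne
    haveI := hisoy
    exact CleanRegAt.functionFieldMap_of_isIso_stalkMap σ y hG

end Summit.ResolutionOfSingularities.ResolutionOfSingularities.Theorems.RadicialJung.CleanModels

end
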